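import Summits.QuantumFields.BalabanUV.T4Continuum.Support.BlockAverageLoopFlux
import HarnessLib

/-!
# YM-DAG node N16 (NE3), the located averaging pin (42) ↔ (0.4) — part 6: THE BLOCK-CENTRING PART OF THE PIN IS A FIRST-MOMENT TERM.
# At constant curvature the first-order exponent of a block average with an ARBITRARY integer stencil offset `s` is EXACTLY
# `L·Σ_m ((L−1)∕2 − s_m)·f_{mκ}`: corner block ([B7] (42)) = `(L(L−1)∕2)Σ_m f_{mκ}`, CENTRED block ([I] (0.4), `L` odd) = `0`, mirror block = sign flip;
# the corner-vs-centred difference is constant per bond direction, i.e. an EXACT (pure-gauge) 1-form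

Cell `pub-ymgap`, width seat `pub-ymgap-dag-n16-w3` (director-ym №197 ∕ HUMAN RULING D-0149), generation 2; part 6 of the W1b sequel (parts 1–5:
p593546 · p594757 · p595773 · p596738 · p597832 — the PERMUTATION part of the pin).  `--kind proof --supports stmt-QuantumFields-20544 --as helper` (K3⁷;
count-neutral; 0 def).  `bears_on: R4∕N16`.

THE POINT.  [Balaban1985Averaging] (42) (tree `B7Prop1Explicit.bavg`) anchors the CORNER block `q + [0,L)ᵈ` at the bond's base point; [Balaban1987RG1] (0.4)
uses the block CENTRED at the base point («`|n_μ| ≦ (L−1)∕2`», p. 252).  The tree's loop-flux evaluation `BlockAverageLoopFlux.Xhat_of_const_flux`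
(`X̂_c = (L(L−1)∕2)•Σ_m f_m` at constant flux) used the abelian Stokes formula for NON-NEGATIVE offsets.  §1–§2 below prove, from the tree's Stokes for ONE
`n × L` rectangle per segment (its backward twin by `asum_seg_neg`) and telescoping along the tree contour, the exact circulation of a constant-flux bond
field around the (42)-loop `Γ_{c,q+v} ∪ (−Γ_c)` for an ARBITRARY integer offset `v` (signed tree contour): **`A(Γ_{c,q+v} ∪ −Γ_c) = L • Σ_m v_m • f_m`**
(`asum_loop_const_flux`).  Hence (§3), for the block average with stencil `{q − s + r : r ∈ [0,L)ᵈ}` (offset `s ∈ ℤᵈ`; `s = 0` is (42), `s = ((L−1)∕2)·𝟙`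
the centred block of (0.4) for odd `L`, `s = (L−1)e_μ` the `μ`-MIRROR of (42)'s block), the first-order exponent at constant flux is the displayed sum
`Σ_r L^{−d} • A(Γ_{c,q−s+r} ∪ −Γ_c) = L • Σ_m ((L−1)∕2 − s_m) • f_m` (`stencil_const_flux`) — the block's FIRST MOMENT about the bond's base point times the
flux: ★ corner `(L(L−1)∕2)Σ_m f_m` (the tree's value, recovered: `corner_const_flux`), ★★ centred = `0` (`centred_const_flux`), ★ `μ`-mirror = corner with
the `m = μ` term's SIGN FLIPPED (`mirror_const_flux`) — so corner-block (42) is NOT reflection-covariant at first order EVEN AT CONSTANT CURVATURE (its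
exponent is not mirror-symmetric), unlike its permutation defect (parts 1–5: zero at constant curvature); and ★ the corner-minus-offset difference
`L•Σ_m s_m•f_{mκ}` depends on the bond DIRECTION only, i.e. it is the EXACT 1-form `d λ`, `λ(y) = Σ_κ y_κ • (L Σ_m s_m f_{mκ})` (`stencil_shift_is_gradient`)
— a pure gauge at the linear∕abelian level: the block-centring part of the located pin is, at constant curvature, EXACTLY a gauge term.

READING FOR N16 (honest).  Together with parts 1–5: the (42) ↔ (0.4) pin p584628 decomposes at first order into [axis-permutation symmetrisation:
`O(L³δ)` on Lipschitz-flux fields, zero at constant curvature — typed] + [block centring (and reflections): a first-moment term which at constant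
curvature is EXACTLY pure gauge — typed here; on Lipschitz-flux fields it is pure gauge up to `O(L³δ)` — NOT typed (needs a signed Stokes for the
general loop)].  Gauge-invariant readings (coarse plaquettes, [B7] Prop. 1 (51)) never see the first-moment term.  Nothing here is about minimisers.

HONEST FRAMING.  [folklore] finite-sum bookkeeping over `B7Prop1Explicit` (`stokes` for one rectangle, `asum_rectWord`, `asum_seg_neg`, `asum_loop_eq`) and
`BlockAverageLoopFlux` (`upper`, `asum_treeWord_upper_succ`, `sum_boxCoord`) BY NAME; 0 `def`, 0 `sorry`; no printed sentence is a hypothesis; nothing of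
[Balaban1985Averaging] ∕ [Balaban1987RG1] asserted beyond what the tree proves; no minimiser, no variational problem; `stub_h7` NOT closed; N16 ∕ NE3 NOT
discharged; count-neutral (typed 28∕28 · discharged 5∕27 unmoved).  One finite four-torus programme at fixed `ε` — the Yang–Mills mass gap (Clay) is NOT
proved by any of this; R4 closes the conditional finite-𝕋⁴ rung `BalabanLadder.UV` only; nothing continuum ∕ ℝ⁴ ∕ OS.
-/

set_option autoImplicit false

open scoped BigOperators
open NormedSpace Finset

namespace Summit.QuantumFields.YangMills.BalabanUVNodes.N16Eq42StencilFirstMoment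

open Literature.MathematicalPhysics.QuantumFieldTheory.Balaban1983to89
open B7Prop1Explicit
open Summit.QuantumFields.BalabanUV.T4Continuum.BlockAverageLoopFlux (upper upper_zero upper_of_le upper_succ_add asum_treeWord_upper_succ
  asum_loop_eq sum_boxCoord)

noncomputable section

variable {d : ℕ}
variable {𝔸 : Type*} [NormedRing 𝔸]

/-! ## §1 One signed segment against its `L e_κ`-translate, at constant flux in the plane `(m, κ)` -/

/-- **FORWARD SEGMENT**: at constant flux `f` in the plane `(m, κ)`, `A([p, p+ne_m]) − A([p+Le_κ, p+Le_κ+ne_m]) = (nL)•f − (g(p+ne_m) − g(p))`,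
`g(y) = A([y, y+Le_κ])` (the tree's abelian Stokes for the `n × L` rectangle, `B7Prop1Explicit.stokes` + `asum_rectWord`). [folklore] -/
theorem segDiff_natCast_const_flux (L : ℕ) (A : Site d → Fin d → 𝔸) (m κ : Fin d) (f : 𝔸)
    (hf : ∀ p : Site d, asum A p (plaqWord m κ) = f) (p : Site d) (n : ℕ) :
    asum A p (seg m n) - asum A (p + (L : ℤ) • e κ) (seg m n)
      = ((n * L : ℕ) : ℤ) • f - (asum A (p + (n : ℤ) • e m) (seg κ L) - asum A p (seg κ L)) := by
  have hS := stokes A p n L m κ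
  rw [asum_rectWord] at hS
  simp only [hf, Finset.sum_const, Finset.card_range, smul_smul] at hS
  rw [← natCast_zsmul] at hS
  -- hS : segₘ(p) + g(p+ne_m) − segₘ(p+Le_κ) − g(p) = (n*L) • f
  have : asum A p (seg m n) - asum A (p + (L : ℤ) • e κ) (seg m n)
      = (asum A p (seg m n) + asum A (p + (n : ℤ) • e m) (seg κ L) - asum A (p + (L : ℤ) • e κ) (seg m n) - asum A p (seg κ L))
        - (asum A (p + (n : ℤ) • e m) (seg κ L) - asum A p (seg κ L)) := by abel
  rw [this, hS, Nat.cast_mul]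

/-- **SIGNED SEGMENT**: the same identity for every integer step count `z` (backward segments by `asum_seg_neg`):
`A(seg m z from p) − A(seg m z from p+Le_κ) = (zL)•f − (g(p+ze_m) − g(p))`. [folklore] -/
theorem segDiff_const_flux (L : ℕ) (A : Site d → Fin d → 𝔸) (m κ : Fin d) (f : 𝔸)
    (hf : ∀ p : Site d, asum A p (plaqWord m κ) = f) (p : Site d) :
    ∀ z : ℤ, asum A p (seg m z) - asum A (p + (L : ℤ) • e κ) (seg m z)
      = (z * L) • f - (asum A (p + z • e m) (seg κ L) - asum A p (seg κ L))
  | Int.ofNat n => by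
    have h := segDiff_natCast_const_flux L A m κ f hf p n
    simp only [Int.ofNat_eq_natCast] at h ⊢
    rw [h]; push_cast; rfl
  | Int.negSucc n => by
    have hneg : (Int.negSucc n : ℤ) = -((n + 1 : ℕ) : ℤ) := rfl
    rw [hneg, asum_seg_neg, asum_seg_neg,
      show p + (L : ℤ) • e κ - ((n + 1 : ℕ) : ℤ) • e m = (p - ((n + 1 : ℕ) : ℤ) • e m) + (L : ℤ) • e κ by abel]
    have h := segDiff_natCast_const_flux L A m κ f hf (p - ((n + 1 : ℕ) : ℤ) • e m) (n + 1)
    rw [show p - ((n + 1 : ℕ) : ℤ) • e m + ((n + 1 : ℕ) : ℤ) • e m = p by abel] at h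
    rw [show p + -((n + 1 : ℕ) : ℤ) • e m = p - ((n + 1 : ℕ) : ℤ) • e m by rw [neg_smul, sub_eq_add_neg],
      show -asum A (p - ((n + 1 : ℕ) : ℤ) • e m) (seg m ((n + 1 : ℕ) : ℤ))
          - -asum A (p - ((n + 1 : ℕ) : ℤ) • e m + (L : ℤ) • e κ) (seg m ((n + 1 : ℕ) : ℤ))
        = -(asum A (p - ((n + 1 : ℕ) : ℤ) • e m) (seg m ((n + 1 : ℕ) : ℤ))
          - asum A (p - ((n + 1 : ℕ) : ℤ) • e m + (L : ℤ) • e κ) (seg m ((n + 1 : ℕ) : ℤ))) by abel, h]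
    rw [Nat.cast_mul, neg_mul, neg_smul]
    push_cast
    abel

/-! ## §2 The (42)-loop at a SIGNED offset: exact circulation at constant flux -/

/-- **★ THE CONSTANT-FLUX CIRCULATION OF THE (42)-LOOP FOR AN ARBITRARY INTEGER OFFSET.**  If the plaquette circulations of `A` in the planes `(m, κ)` are
independent of the base point (`A(∂p)_p(plaqWord m κ) = f m`), then for EVERY `v ∈ ℤᵈ` (signed tree contour `Γ_{q,q+v}`, axes `d−1, …, 0`):
`A(Γ_{c,q+v} ∪ (−Γ_c)) = L • Σ_m v_m • f_m` — telescoping along the tree contour (`BlockAverageLoopFlux.asum_treeWord_upper_succ`) with §1 on every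
segment; the straight-segment terms `g` telescope away.  For `v ≥ 0` this is the tree's loop-flux value; the sign-general form is what offset (centred,
mirror) stencils need. [folklore] -/
theorem asum_loop_const_flux (L : ℕ) (A : Site d → Fin d → 𝔸) (q : Site d) (κ : Fin d) (f : Fin d → 𝔸)
    (hf : ∀ (p : Site d) (m : Fin d), asum A p (plaqWord m κ) = f m) (v : Site d) :
    asum A q (gammaWord L κ v ++ seg κ (-(L : ℤ))) = ∑ m : Fin d, (v m * L) • f m := by
  -- the telescope: G k = [tree part from coordinate k on] + [straight part]
  set G : ℕ → 𝔸 := fun k =>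
    (asum A q (treeWord (upper k v)) - asum A (q + (L : ℤ) • e κ) (treeWord (upper k v)))
      + (asum A (q + upper k v) (seg κ L) - asum A q (seg κ L)) with hG
  have h0 : G 0 = asum A q (gammaWord L κ v ++ seg κ (-(L : ℤ))) := by
    rw [asum_loop_eq]; simp [hG]
  have hd : G d = 0 := by simp [hG, upper_of_le le_rfl]
  have hstep : ∀ m : Fin d, G m - G ((m : ℕ) + 1) = (v m * L) • f m := by
    intro m
    simp only [hG]
    rw [asum_treeWord_upper_succ A q m v, asum_treeWord_upper_succ A (q + (L : ℤ) • e κ) m v, ← upper_succ_add m v,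
      show q + (L : ℤ) • e κ + upper ((m : ℕ) + 1) v = q + upper ((m : ℕ) + 1) v + (L : ℤ) • e κ by abel]
    have hseg := segDiff_const_flux L A m κ (f m) (fun p => hf p m) (q + upper ((m : ℕ) + 1) v) (v m)
    rw [show q + (upper ((m : ℕ) + 1) v + v m • e m) = q + upper ((m : ℕ) + 1) v + v m • e m by abel]
    -- abbreviate the pieces
    set T := asum A q (treeWord (upper ((m : ℕ) + 1) v)) with hT
    set T' := asum A (q + (L : ℤ) • e κ) (treeWord (upper ((m : ℕ) + 1) v)) with hT'
    set S := asum A (q + upper ((m : ℕ) + 1) v) (seg m (v m)) with hS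
    set S' := asum A (q + upper ((m : ℕ) + 1) v + (L : ℤ) • e κ) (seg m (v m)) with hS'
    set g₁ := asum A (q + upper ((m : ℕ) + 1) v + v m • e m) (seg κ L) with hg₁
    set g₀ := asum A (q + upper ((m : ℕ) + 1) v) (seg κ L) with hg₀
    set gq := asum A q (seg κ L) with hgq
    have hseg' : S - S' = (v m * L) • f m - (g₁ - g₀) := hseg
    calc T + S - (T' + S') + (g₁ - gq) - (T - T' + (g₀ - gq)) = (S - S') + (g₁ - g₀) := by abel
      _ = (v m * L) • f m := by rw [hseg']; abel
  have htel : ∑ m ∈ Finset.range d, (G m - G (m + 1)) = G 0 - G d := Finset.sum_range_sub' G d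
  rw [← h0, ← sub_zero (G 0), ← hd, ← htel, ← Fin.sum_univ_eq_sum_range (fun k => G k - G (k + 1)) d]
  exact Finset.sum_congr rfl fun m _ => hstep m

/-! ## §3 Stencils: corner (42), offset, centred (0.4), mirror — the first moment at constant curvature -/

/-- **★★ THE FIRST-MOMENT FORMULA.**  At constant flux in the planes `(m, κ)`, the first-order exponent of the block average with the stencil
`{q − s + r : r ∈ [0,L)ᵈ}` — the DISPLAYED sum `Σ_r L^{−d} • A(Γ_{c, q−s+r} ∪ −Γ_c)` (`s = 0`: the tree's `Xhat L A q κ`, [B7] (42)) — equals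
`Σ_m (L·((L−1)∕2 − s_m)) • f_m`: `L ×` (the block's FIRST MOMENT about the bond's base point) `×` flux (`BlockAverageLoopFlux.sum_boxCoord`:
`Σ_{r∈[0,L)ᵈ} r_m = L^d (L−1)∕2`). [folklore] -/
theorem stencil_const_flux (L : ℕ) (hL : 1 ≤ L) (A : Site d → Fin d → 𝔸) (q : Site d) (κ : Fin d) (f : Fin d → 𝔸)
    (hf : ∀ (p : Site d) (m : Fin d), asum A p (plaqWord m κ) = f m) (s : Site d) [NormedAlgebra ℂ 𝔸] :
    ∑ r : Fin d → Fin L, (((L : ℝ) ^ d)⁻¹) • asum A q (gammaWord L κ (boxVec L r - s) ++ seg κ (-(L : ℤ)))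
      = ∑ m : Fin d, ((L : ℝ) * (((L : ℝ) - 1) / 2 - (s m : ℝ))) • f m := by
  have hL0 : (0 : ℝ) < (L : ℝ) ^ d := pow_pos (by exact_mod_cast (by omega : 0 < L)) _
  simp_rw [asum_loop_const_flux L A q κ f hf, Finset.smul_sum, Pi.sub_apply]
  rw [Finset.sum_comm]
  refine Finset.sum_congr rfl fun m _ => ?_
  -- Σ_r L^{-d} • ((r_m − s_m) L) • f_m = (L((L−1)/2 − s_m)) • f_m
  have hcast : ∀ r : Fin d → Fin L, (((L : ℝ) ^ d)⁻¹) • (((boxVec L r m - s m) * L) • f m)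
      = ((((L : ℝ) ^ d)⁻¹) * ((((r m : ℕ) : ℝ) - (s m : ℝ)) * L)) • f m := by
    intro r
    rw [← Int.cast_smul_eq_zsmul ℝ, smul_smul]
    congr 1
    simp [boxVec]
  simp_rw [hcast]
  rw [← Finset.sum_smul]
  congr 1
  rw [← Finset.mul_sum, ← Finset.sum_mul, Finset.sum_sub_distrib, sum_boxCoord L m, Finset.sum_const, Finset.card_univ,
    Fintype.card_fun, Fintype.card_fin, Fintype.card_fin, nsmul_eq_mul]
  push_cast
  field_simp

/-- **★ CORNER BLOCK (42)**: `s = 0` recovers the tree's value `(L(L−1)∕2)•Σ_m f_m` (`BlockAverageLoopFlux.Xhat_of_const_flux`) — the first moment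
`L^d(L−1)∕2 ≠ 0` of the corner block is what makes (42)'s exponent non-zero at constant curvature. [folklore] -/
theorem corner_const_flux (L : ℕ) (hL : 1 ≤ L) (A : Site d → Fin d → 𝔸) (q : Site d) (κ : Fin d) (f : Fin d → 𝔸)
    (hf : ∀ (p : Site d) (m : Fin d), asum A p (plaqWord m κ) = f m) [NormedAlgebra ℂ 𝔸] :
    Xhat L A q κ = ∑ m : Fin d, ((L : ℝ) * (((L : ℝ) - 1) / 2)) • f m := by
  have h := stencil_const_flux L hL A q κ f hf 0
  simp only [sub_zero, Pi.zero_apply, Int.cast_zero] at h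
  exact h

/-- **★★ CENTRED BLOCK ([I] (0.4), `L = 2M+1` odd, `s = M·𝟙`)**: the first moment vanishes, so the first-order exponent of the CENTRED stencil IS ZERO
at constant curvature — the centred average equals the straight transporter to first order. [cite: Balaban1987RG1, p.252 («|n_μ| ≦ (L−1)/2»)] -/
theorem centred_const_flux (M : ℕ) (A : Site d → Fin d → 𝔸) (q : Site d) (κ : Fin d) (f : Fin d → 𝔸)
    (hf : ∀ (p : Site d) (m : Fin d), asum A p (plaqWord m κ) = f m) [NormedAlgebra ℂ 𝔸] :
    ∑ r : Fin d → Fin (2 * M + 1), ((((2 * M + 1 : ℕ) : ℝ) ^ d)⁻¹) •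
        asum A q (gammaWord (2 * M + 1) κ (boxVec (2 * M + 1) r - fun _ => (M : ℤ)) ++ seg κ (-((2 * M + 1 : ℕ) : ℤ))) = 0 := by
  rw [stencil_const_flux (2 * M + 1) (by omega) A q κ f hf]
  refine Finset.sum_eq_zero fun m _ => ?_
  have : ((((2 * M + 1 : ℕ) : ℝ)) - 1) / 2 - ((M : ℤ) : ℝ) = 0 := by push_cast; ring
  rw [this, mul_zero, zero_smul]

/-- **★ THE `μ`-MIRROR OF THE CORNER BLOCK** (`s = (L−1)•e_μ`: the block on the other side of the base point in the direction `μ`): its exponent at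
constant curvature is the corner value with the `m = μ` term's SIGN FLIPPED, `Σ_{m} (L((L−1)∕2)·(if m = μ then −1 else 1)) • f_m` — so (42)'s exponent is
NOT mirror-symmetric at constant curvature unless `f_{μκ} = 0`: corner-block averaging breaks REFLECTION covariance at first order, already at constant
curvature (contrast parts 1–5: the PERMUTATION defect vanishes there). [folklore] -/
theorem mirror_const_flux (L : ℕ) (hL : 1 ≤ L) (A : Site d → Fin d → 𝔸) (q : Site d) (κ μ : Fin d) (f : Fin d → 𝔸)
    (hf : ∀ (p : Site d) (m : Fin d), asum A p (plaqWord m κ) = f m) [NormedAlgebra ℂ 𝔸] :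
    ∑ r : Fin d → Fin L, (((L : ℝ) ^ d)⁻¹) • asum A q (gammaWord L κ (boxVec L r - (((L : ℤ) - 1) • e μ)) ++ seg κ (-(L : ℤ)))
      = ∑ m : Fin d, ((L : ℝ) * (((L : ℝ) - 1) / 2) * (if m = μ then -1 else 1)) • f m := by
  rw [stencil_const_flux L hL A q κ f hf]
  refine Finset.sum_congr rfl fun m _ => ?_
  congr 1
  by_cases hm : m = μ
  · subst hm
    simp only [Pi.smul_apply, e_apply, if_true, smul_eq_mul, mul_one]
    push_cast; ring
  · simp only [Pi.smul_apply, e_apply, hm, if_false, smul_eq_mul, mul_zero, Int.cast_zero, sub_zero, mul_one]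

/-- **★ CORNER MINUS OFFSET IS A GRADIENT.**  At constant curvature the corner stencil exceeds the `s`-offset stencil by `(L•Σ_m s_m•f_{m})` at EVERY base point
`q` — a bond function depending on the bond direction `κ` only (through the hypothesis' plane data `f = f_{·κ}`); such a 1-form is EXACT:
`c = λ(q + e_κ) − λ(q)` with `λ(y) = Σ_ν y_ν • c_ν`.  So the block-centring part of the pin (42) ↔ (0.4) is, at constant curvature and at the linear ∕
abelian level, EXACTLY a pure gauge. [folklore] -/
theorem stencil_shift_is_gradient (c : Fin d → 𝔸) (q : Site d) (κ : Fin d) :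
    c κ = (∑ ν : Fin d, ((q + e κ) ν) • c ν) - ∑ ν : Fin d, (q ν) • c ν := by
  rw [← Finset.sum_sub_distrib]
  have : ∀ ν : Fin d, ((q + e κ) ν) • c ν - (q ν) • c ν = if ν = κ then c κ else 0 := by
    intro ν
    rw [← sub_smul, Pi.add_apply, add_sub_cancel_left, e_apply]
    split_ifs with h
    · subst h; rw [one_smul]
    · rw [zero_smul]
  rw [Finset.sum_congr rfl fun ν _ => this ν, Finset.sum_ite_eq' Finset.univ κ, if_pos (Finset.mem_univ κ)]

/-- The corner-minus-offset difference itself, at constant curvature: `X̂(q,κ) − (offset-`s` exponent)(q,κ) = Σ_m (L·s_m) • f_m`, independent of `q`.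
[folklore] -/
theorem corner_sub_stencil_const_flux (L : ℕ) (hL : 1 ≤ L) (A : Site d → Fin d → 𝔸) (q : Site d) (κ : Fin d) (f : Fin d → 𝔸)
    (hf : ∀ (p : Site d) (m : Fin d), asum A p (plaqWord m κ) = f m) (s : Site d) [NormedAlgebra ℂ 𝔸] :
    Xhat L A q κ - ∑ r : Fin d → Fin L, (((L : ℝ) ^ d)⁻¹) • asum A q (gammaWord L κ (boxVec L r - s) ++ seg κ (-(L : ℤ)))
      = ∑ m : Fin d, ((L : ℝ) * (s m : ℝ)) • f m := by
  rw [corner_const_flux L hL A q κ f hf, stencil_const_flux L hL A q κ f hf s, ← Finset.sum_sub_distrib]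
  refine Finset.sum_congr rfl fun m _ => ?_
  rw [← sub_smul]
  congr 1
  ring

end

end Summit.QuantumFields.YangMills.BalabanUVNodes.N16Eq42StencilFirstMoment
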